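import Literature.Analysis.FunctionSpaces.TorusShearKoopman
import Mathlib.Analysis.SpecialFunctions.SmoothTransition
import Mathlib.Analysis.Calculus.Deriv.Abs
import Mathlib.Analysis.SpecialFunctions.Integrals.Basic
import HarnessLib

/-!
# Shear-cascade profiles: smooth near-triangle waves and their oscillatory means

Analysis/FluidPDE support file (all proved; no named facts) for the alternating-shear
discharge of `Literature.Analysis.FluidPDE.cheskidov_time_periodic_anomaly` (`ShearCascade*`).
The shears of the cascade have displacement profiles `D · S_w(F t)` where `S_w` is the
**triangle wave with flattened corners**:

* `ShearCascade.tri` — the triangle wave of period `1`, slopes `±4`, range `[-1,1]`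
  (`tri t = 1 - 4|fract t - 1/2|`; affine descriptions on the half periods, continuity,
  half-period antisymmetry `tri(t + 1/2) = -tri t`);
* `ShearCascade.clamp w` — an odd smooth clamp `ψ_w`, the identity on `[-(1-w), 1-w]` and the
  constants `±(1 - w/2)` beyond `±(1 - w/2)` (built from `Real.smoothTransition`);
* `ShearCascade.nearTri w = ψ_w ∘ tri` and the bundled `ShearCascade.profile w : Torus.ShearProfile`
  (`0 < w ≤ 1`): smooth (`contDiff_nearTri`: locally a composition of smooth maps or a constant),
  `1`-periodic, `|S_w| ≤ 1`, mean zero over a period (`intervalIntegral_nearTri`), and `= tri`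
  off the corner windows `{|tri| > 1 - w}` (total length `w` per period);
* the **oscillatory means** `ShearCascade.oscMean S a = ∫₀¹ exp(-2πi a S(t)) dt` — by
  `Torus.fourierCoeff_twist_scale_zero` the Fourier multiplier by which such a shear acts on a
  mode of transversal frequency `n`, `a = nD` (`fourierCoeff_twist_profile_scale_zero`) — with the
  two estimates the cascade needs: `|c_tri(a)| ≤ |sin 2πa|/(2π|a|)` (`norm_oscMean_tri_le`; the
  mean of the sharp triangle wave is `sin(2πa)/(2πa)`, vanishing at the nonzero half-integers),
  `|c_{S_w}(a) - c_tri(a)| ≤ 2w` (`norm_oscMean_nearTri_sub_le`), hence the **residue bound**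
  `|c_{S_w}(l/2 + ε)| ≤ 4|ε| + 2w` for `l ∈ ℤ ∖ {0}`, `|ε| ≤ 1/4` (`norm_oscMean_nearTri_le`).

The point of the triangle shape: in the cascade the phases seen by the travelling front are
`(j + l F_{s-1}) · D_s` with `D_s = 1/(2F_{s-1})`, i.e. `l/2 +` tiny, where the mean of a
triangle-wave shear (unlike a sinusoidal one, whose mean is a Bessel function) is exactly small.

## Mathlib / tree search

Mathlib: `Int.fract`, `ContinuousOn.comp_fract''`, `Real.smoothTransition`, `contDiffAt_abs`,
`integral_exp_mul_complex`, `Complex.norm_exp_I_mul_ofReal_sub_one`, `Real.sin_add_int_mul_pi`,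
`Real.abs_sin_le_abs`; no triangle/sawtooth waves (searched `triangle`, `sawtooth`, `zigzag`:
none as periodic real functions). Tree: `Torus.ShearProfile`, `Torus.twist`,
`Torus.fourierCoeff_twist_scale_zero` (`FunctionSpaces/TorusShearKoopman`).

## References

* R. T. Pierrehumbert, *Tracer microstructure in the large-eddy dominated regime*, Chaos
  Solitons Fractals 4 (1994) 1091–1110 (alternating shear maps as mixers) — context only.
* A. Cheskidov, arXiv:2311.04182 (2023), §6 (the periodisation these profiles feed).
-/

open MeasureTheory Set Filter Topology Function intervalIntegral
open scoped ContDiff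

noncomputable section

namespace Literature.Analysis.FluidPDE

namespace ShearCascade

/-! ## The triangle wave -/

/-- **The triangle wave** of period `1`, slopes `±4`, range `[-1, 1]`, minimum `-1` at the
integers and maximum `1` at the half-integers: `tri t = 1 - 4 |fract t - 1/2|`. [folklore] -/
def tri (t : ℝ) : ℝ := 1 - 4 * |Int.fract t - 2⁻¹|

/-- `tri` is `1`-periodic. [folklore] -/
theorem tri_periodic : Function.Periodic tri 1 := fun t => by
  simp [tri]

/-- `tri (t + n) = tri t`. [folklore] -/
theorem tri_add_int (t : ℝ) (n : ℤ) : tri (t + n) = tri t := by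
  simp [tri]

/-- On `[0, 1)`: `tri t = 1 - 4|t - 1/2|`. [folklore] -/
theorem tri_of_mem_Ico {t : ℝ} (ht : t ∈ Ico (0 : ℝ) 1) : tri t = 1 - 4 * |t - 2⁻¹| := by
  rw [tri, Int.fract_eq_self.2 ht]

/-- On `[0, 1/2]`: `tri t = 4t - 1`. [folklore] -/
theorem tri_of_mem_Icc_left {t : ℝ} (ht : t ∈ Icc (0 : ℝ) 2⁻¹) : tri t = 4 * t - 1 := by
  rw [tri_of_mem_Ico ⟨ht.1, by linarith [ht.2]⟩, abs_of_nonpos (by linarith [ht.2])]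
  ring

/-- On `[1/2, 1)`: `tri t = 3 - 4t`. [folklore] -/
theorem tri_of_mem_Ico_right {t : ℝ} (ht : t ∈ Ico (2⁻¹ : ℝ) 1) : tri t = 3 - 4 * t := by
  rw [tri_of_mem_Ico ⟨by linarith [ht.1], ht.2⟩, abs_of_nonneg (by linarith [ht.1])]
  ring

/-- On `[1/2, 1]`: `tri t = 3 - 4t` (the value at `1` is `-1` by periodicity). [folklore] -/
theorem tri_of_mem_Icc_right {t : ℝ} (ht : t ∈ Icc (2⁻¹ : ℝ) 1) : tri t = 3 - 4 * t := by
  rcases eq_or_lt_of_le ht.2 with rfl | h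
  · have := tri_add_int 0 1
    simp only [Int.cast_one, zero_add] at this
    rw [this, tri_of_mem_Icc_left ⟨le_rfl, by norm_num⟩]
    norm_num
  · exact tri_of_mem_Ico_right ⟨ht.1, h⟩

/-- On `(-1/2, 1/2)`: `tri t = 4|t| - 1`. [folklore] -/
theorem tri_of_abs_lt {t : ℝ} (ht : |t| < 2⁻¹) : tri t = 4 * |t| - 1 := by
  rcases le_or_gt 0 t with h | h
  · rw [abs_of_nonneg h] at ht ⊢
    exact tri_of_mem_Icc_left ⟨h, ht.le⟩
  · rw [abs_of_neg h] at ht ⊢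
    have hfr : Int.fract t = t + 1 := by
      rw [Int.fract_eq_iff]
      exact ⟨by linarith, by linarith, -1, by simp⟩
    rw [tri, hfr, abs_of_pos (by linarith)]
    ring

/-- `|tri t| ≤ 1`. [folklore] -/
theorem abs_tri_le (t : ℝ) : |tri t| ≤ 1 := by
  rw [tri]
  have h0 := Int.fract_nonneg t
  have h1 := Int.fract_lt_one t
  have h2 : |Int.fract t - 2⁻¹| ≤ 2⁻¹ := abs_le.2 ⟨by linarith, by linarith⟩
  have h3 := abs_nonneg (Int.fract t - 2⁻¹)
  exact abs_le.2 ⟨by linarith, by linarith⟩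

/-- `tri` is continuous (a continuous function of `fract` with matching end values). [folklore] -/
theorem continuous_tri : Continuous tri :=
  ContinuousOn.comp_fract'' (f := fun y : ℝ => 1 - 4 * |y - 2⁻¹|) (by fun_prop) (by norm_num)

/-- Half-period antisymmetry: `tri (t + 1/2) = -tri t`. [folklore] -/
theorem tri_add_half (t : ℝ) : tri (t + 2⁻¹) = -tri t := by
  -- reduce to `t ∈ [0, 1)`
  have key : ∀ u ∈ Ico (0 : ℝ) 1, tri (u + 2⁻¹) = -tri u := by
    intro u hu
    have hu0 := hu.1
    have hu1 := hu.2
    rcases lt_or_ge u 2⁻¹ with h | h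
    · rw [tri_of_mem_Icc_left ⟨hu0, h.le⟩, tri_of_mem_Ico_right ⟨by linarith, by linarith⟩]
      ring
    · have h1 : tri (u + 2⁻¹) = tri (u + 2⁻¹ - 1) := by
        have := tri_add_int (u + 2⁻¹ - 1) 1
        simp only [Int.cast_one, sub_add_cancel] at this
        exact this
      rw [h1, tri_of_mem_Ico_right ⟨h, hu1⟩, tri_of_mem_Icc_left ⟨by linarith, by linarith⟩]
      ring
  have ht : t = Int.fract t + ⌊t⌋ := (Int.fract_add_floor t).symm
  rw [ht, add_right_comm, tri_add_int, tri_add_int]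
  exact key _ ⟨Int.fract_nonneg t, Int.fract_lt_one t⟩

/-! ## The odd smooth clamp `ψ_w` -/

section Clamp

variable {w : ℝ}

/-- The ramp `σ_w`: smooth, `0` for `y ≤ 1 - w`, `1` for `y ≥ 1 - w/2`, values in `[0, 1]`. [folklore] -/
def ramp (w y : ℝ) : ℝ := Real.smoothTransition ((y - (1 - w)) / (w / 2))

/-- `σ_w` is smooth. [folklore] -/
theorem contDiff_ramp (w : ℝ) : ContDiff ℝ ∞ (ramp w) :=
  Real.smoothTransition.contDiff.comp ((contDiff_id.sub contDiff_const).div_const _)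

/-- `σ_w y = 0` for `y ≤ 1 - w` (`w > 0`). [folklore] -/
theorem ramp_of_le (hw : 0 < w) {y : ℝ} (hy : y ≤ 1 - w) : ramp w y = 0 :=
  Real.smoothTransition.zero_of_nonpos (div_nonpos_of_nonpos_of_nonneg (by linarith) (by linarith))

/-- `σ_w y = 1` for `y ≥ 1 - w/2` (`w > 0`). [folklore] -/
theorem ramp_of_ge (hw : 0 < w) {y : ℝ} (hy : 1 - w / 2 ≤ y) : ramp w y = 1 :=
  Real.smoothTransition.one_of_one_le ((one_le_div (by linarith)).2 (by linarith))

/-- `0 ≤ σ_w ≤ 1`. [folklore] -/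
theorem ramp_mem_Icc (w y : ℝ) : ramp w y ∈ Icc (0 : ℝ) 1 :=
  ⟨Real.smoothTransition.nonneg _, Real.smoothTransition.le_one _⟩

/-- **The odd smooth clamp** `ψ_w(y) = y (1 - σ_w(y) - σ_w(-y)) + (1 - w/2)(σ_w(y) - σ_w(-y))`:
the identity on `[-(1-w), 1-w]`, the constants `±(1 - w/2)` beyond `±(1 - w/2)`, odd, smooth,
with values in `[-1, 1]`. [folklore] -/
def clamp (w y : ℝ) : ℝ := y * (1 - ramp w y - ramp w (-y)) + (1 - w / 2) * (ramp w y - ramp w (-y))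

/-- `ψ_w` is smooth. [folklore] -/
theorem contDiff_clamp (w : ℝ) : ContDiff ℝ ∞ (clamp w) := by
  have h1 := contDiff_ramp w
  have h2 : ContDiff ℝ ∞ fun y => ramp w (-y) := h1.comp contDiff_neg
  unfold clamp
  exact (contDiff_id.mul ((contDiff_const.sub h1).sub h2)).add (contDiff_const.mul (h1.sub h2))

/-- `ψ_w` is odd. [folklore] -/
theorem clamp_neg (w y : ℝ) : clamp w (-y) = -clamp w y := by
  simp only [clamp, neg_neg]; ring

/-- `ψ_w(y) = y` for `|y| ≤ 1 - w` (`0 < w`). [folklore] -/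
theorem clamp_of_abs_le (hw : 0 < w) {y : ℝ} (hy : |y| ≤ 1 - w) : clamp w y = y := by
  rw [abs_le] at hy
  rw [clamp, ramp_of_le hw hy.2, ramp_of_le hw (by linarith)]
  ring

/-- `ψ_w(y) = 1 - w/2` for `y ≥ 1 - w/2` (`0 < w ≤ 1`). [folklore] -/
theorem clamp_of_ge (hw : 0 < w) (hw1 : w ≤ 1) {y : ℝ} (hy : 1 - w / 2 ≤ y) : clamp w y = 1 - w / 2 := by
  rw [clamp, ramp_of_ge hw hy, ramp_of_le hw (by linarith)]
  ring

/-- `ψ_w(y) = -(1 - w/2)` for `y ≤ -(1 - w/2)` (`0 < w ≤ 1`). [folklore] -/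
theorem clamp_of_le (hw : 0 < w) (hw1 : w ≤ 1) {y : ℝ} (hy : y ≤ -(1 - w / 2)) : clamp w y = -(1 - w / 2) := by
  have h := clamp_of_ge hw hw1 (y := -y) (by linarith)
  rw [clamp_neg] at h
  linarith

/-- `|ψ_w(y)| ≤ 1` (`0 < w ≤ 1`). [folklore] -/
theorem abs_clamp_le (hw : 0 < w) (hw1 : w ≤ 1) (y : ℝ) : |clamp w y| ≤ 1 := by
  -- by oddness it suffices to treat `y ≥ 0`
  suffices key : ∀ y, 0 ≤ y → |clamp w y| ≤ 1 by
    rcases le_or_gt 0 y with h | h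
    · exact key y h
    · have := key (-y) (by linarith)
      rwa [clamp_neg, abs_neg] at this
  intro y hy
  have hr0 : ramp w (-y) = 0 := ramp_of_le hw (by linarith)
  rw [clamp, hr0, sub_zero, sub_zero]
  obtain ⟨h0, h1⟩ := ramp_mem_Icc w y
  rcases le_or_gt y (1 - w / 2) with hy' | hy'
  · -- convex combination of `y ∈ [0, 1 - w/2]` and `1 - w/2`
    rw [abs_le]
    constructor <;> nlinarith
  · rw [ramp_of_ge hw hy'.le]
    rw [abs_le]; constructor <;> nlinarith

end Clamp

/-! ## The near-triangle profile `S_w = ψ_w ∘ tri` -/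

section Profile

variable {w : ℝ}

/-- **The near-triangle profile** `S_w = ψ_w ∘ tri`: the triangle wave with its corners flattened
over windows of height `w` (smooth, `1`-periodic, odd about the quarter periods, `|S_w| ≤ 1`,
`= tri` where `|tri| ≤ 1 - w`). [folklore] -/
def nearTri (w : ℝ) (t : ℝ) : ℝ := clamp w (tri t)

/-- Unfolding `S_w`. [folklore] -/
theorem nearTri_apply (w t : ℝ) : nearTri w t = clamp w (tri t) := rfl

/-- `S_w` is `1`-periodic. [folklore] -/
theorem nearTri_periodic (w : ℝ) : Function.Periodic (nearTri w) 1 := fun t => by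
  rw [nearTri_apply, nearTri_apply, tri_periodic]

/-- `S_w (t + n) = S_w t`. [folklore] -/
theorem nearTri_add_int (w t : ℝ) (n : ℤ) : nearTri w (t + n) = nearTri w t := by
  rw [nearTri_apply, nearTri_apply, tri_add_int]

/-- `|S_w| ≤ 1` (`0 < w ≤ 1`). [folklore] -/
theorem abs_nearTri_le (hw : 0 < w) (hw1 : w ≤ 1) (t : ℝ) : |nearTri w t| ≤ 1 :=
  abs_clamp_le hw hw1 _

/-- Half-period antisymmetry: `S_w (t + 1/2) = -S_w t`. [folklore] -/
theorem nearTri_add_half (w t : ℝ) : nearTri w (t + 2⁻¹) = -nearTri w t := by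
  rw [nearTri_apply, nearTri_apply, tri_add_half, clamp_neg]

/-- `S_w = tri` off the corner windows `{|tri| > 1 - w}`. [folklore] -/
theorem nearTri_eq_tri (hw : 0 < w) {t : ℝ} (ht : |tri t| ≤ 1 - w) : nearTri w t = tri t :=
  clamp_of_abs_le hw ht

/-- Smoothness of `S_w` on the open period `(0, 1)`, where `tri = 1 - 4|· - 1/2|`: away from
`1/2` a composition of smooth maps, at `1/2` locally the constant `1 - w/2`. [folklore] -/
theorem contDiffAt_nearTri_of_mem_Ioo (hw : 0 < w) (hw1 : w ≤ 1) {t : ℝ} (ht : t ∈ Ioo (0 : ℝ) 1) :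
    ContDiffAt ℝ ∞ (nearTri w) t := by
  have hev : (nearTri w) =ᶠ[𝓝 t] fun s => clamp w (1 - 4 * |s - 2⁻¹|) := by
    filter_upwards [Ioo_mem_nhds ht.1 ht.2] with s hs
    rw [nearTri_apply, tri_of_mem_Ico ⟨hs.1.le, hs.2⟩]
  by_cases h : t = 2⁻¹
  · subst h
    have hconst : (fun s : ℝ => clamp w (1 - 4 * |s - 2⁻¹|)) =ᶠ[𝓝 (2⁻¹ : ℝ)] fun _ => 1 - w / 2 := by
      have hmem : Ioo (2⁻¹ - w / 8) (2⁻¹ + w / 8) ∈ 𝓝 (2⁻¹ : ℝ) := Ioo_mem_nhds (by linarith) (by linarith)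
      filter_upwards [hmem] with s hs
      refine clamp_of_ge hw hw1 ?_
      have : |s - 2⁻¹| < w / 8 := abs_lt.2 ⟨by linarith [hs.1], by linarith [hs.2]⟩
      linarith
    exact (contDiffAt_const.congr_of_eventuallyEq hconst).congr_of_eventuallyEq hev
  · have habs : ContDiffAt ℝ ∞ (fun s : ℝ => |s - 2⁻¹|) t :=
      (contDiffAt_abs (sub_ne_zero.2 h)).comp t (contDiffAt_id.sub contDiffAt_const)
    have hin : ContDiffAt ℝ ∞ (fun s : ℝ => 1 - 4 * |s - 2⁻¹|) t := contDiffAt_const.sub (contDiffAt_const.mul habs)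
    exact ((contDiff_clamp w).contDiffAt.comp t hin).congr_of_eventuallyEq hev

/-- Smoothness of `S_w` on `(-1/2, 1/2)`, where `tri = 4|·| - 1`: away from `0` a composition of
smooth maps, at `0` locally the constant `-(1 - w/2)`. [folklore] -/
theorem contDiffAt_nearTri_of_abs_lt (hw : 0 < w) (hw1 : w ≤ 1) {t : ℝ} (ht : |t| < 2⁻¹) :
    ContDiffAt ℝ ∞ (nearTri w) t := by
  have hev : (nearTri w) =ᶠ[𝓝 t] fun s => clamp w (4 * |s| - 1) := by
    have hmem : Ioo (-(2⁻¹ : ℝ)) 2⁻¹ ∈ 𝓝 t := Ioo_mem_nhds (by linarith [(abs_lt.1 ht).1]) (abs_lt.1 ht).2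
    filter_upwards [hmem] with s hs
    rw [nearTri_apply, tri_of_abs_lt (abs_lt.2 ⟨hs.1, hs.2⟩)]
  by_cases h : t = 0
  · subst h
    have hconst : (fun s : ℝ => clamp w (4 * |s| - 1)) =ᶠ[𝓝 (0 : ℝ)] fun _ => -(1 - w / 2) := by
      have hmem : Ioo (-(w / 8)) (w / 8) ∈ 𝓝 (0 : ℝ) := Ioo_mem_nhds (by linarith) (by linarith)
      filter_upwards [hmem] with s hs
      refine clamp_of_le hw hw1 ?_
      have : |s| < w / 8 := abs_lt.2 ⟨hs.1, hs.2⟩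
      linarith
    exact (contDiffAt_const.congr_of_eventuallyEq hconst).congr_of_eventuallyEq hev
  · have habs : ContDiffAt ℝ ∞ (fun s : ℝ => |s|) t := contDiffAt_abs h
    have hin : ContDiffAt ℝ ∞ (fun s : ℝ => 4 * |s| - 1) t := (contDiffAt_const.mul habs).sub contDiffAt_const
    exact ((contDiff_clamp w).contDiffAt.comp t hin).congr_of_eventuallyEq hev

/-- **`S_w` is smooth** (`0 < w ≤ 1`): reduce by periodicity to `[0, 1)` and use the two local
descriptions. [folklore] -/
theorem contDiff_nearTri (hw : 0 < w) (hw1 : w ≤ 1) : ContDiff ℝ ∞ (nearTri w) := by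
  refine contDiff_iff_contDiffAt.2 fun t => ?_
  -- translate to the fundamental period
  have hshift : nearTri w = nearTri w ∘ fun s => s - ⌊t⌋ := by
    funext s
    simp only [Function.comp_apply]
    have := nearTri_add_int w (s - ⌊t⌋) ⌊t⌋
    rw [sub_add_cancel] at this
    exact this
  have hu0 : 0 ≤ Int.fract t := Int.fract_nonneg t
  have hu1 : Int.fract t < 1 := Int.fract_lt_one t
  have hloc : ContDiffAt ℝ ∞ (nearTri w) (Int.fract t) := by
    rcases eq_or_lt_of_le hu0 with h | h
    · rw [← h]; exact contDiffAt_nearTri_of_abs_lt hw hw1 (by simp)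
    · exact contDiffAt_nearTri_of_mem_Ioo hw hw1 ⟨h, hu1⟩
  rw [hshift]
  refine ContDiffAt.comp t ?_ (contDiffAt_id.sub contDiffAt_const)
  rw [Int.self_sub_floor]
  exact hloc

/-- `S_w` is continuous. [folklore] -/
theorem continuous_nearTri (hw : 0 < w) (hw1 : w ≤ 1) : Continuous (nearTri w) :=
  (contDiff_nearTri hw hw1).continuous

/-- **`S_w` has zero mean over a period** (half-period antisymmetry). [folklore] -/
theorem intervalIntegral_nearTri (hw : 0 < w) (hw1 : w ≤ 1) : ∫ t in (0 : ℝ)..1, nearTri w t = 0 := by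
  have hc := continuous_nearTri hw hw1
  have hsplit := intervalIntegral.integral_add_adjacent_intervals
    (hc.intervalIntegrable (μ := volume) 0 2⁻¹) (hc.intervalIntegrable (μ := volume) 2⁻¹ 1)
  rw [← hsplit]
  have h2 : ∫ t in (2⁻¹ : ℝ)..1, nearTri w t = -∫ t in (0 : ℝ)..2⁻¹, nearTri w t := by
    have := intervalIntegral.integral_comp_add_right (a := 0) (b := 2⁻¹) (fun t => nearTri w t) (2⁻¹ : ℝ)
    rw [zero_add, show (2⁻¹ : ℝ) + 2⁻¹ = 1 by norm_num] at this
    rw [← this]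
    simp only [nearTri_add_half]
    exact intervalIntegral.integral_neg
  rw [h2, add_neg_cancel]

/-- **The cascade profile of width `w`** as a `Torus.ShearProfile`. [folklore] -/
def profile (w : ℝ) (hw : 0 < w) (hw1 : w ≤ 1) : FunctionSpaces.Torus.ShearProfile where
  toFun := nearTri w
  periodic' := nearTri_periodic w
  contDiff' := contDiff_nearTri hw hw1

/-- The profile function is `S_w`. [folklore] -/
@[simp]
theorem profile_apply (hw : 0 < w) (hw1 : w ≤ 1) (t : ℝ) : profile w hw hw1 t = nearTri w t := rfl

end Profile

/-! ## Oscillatory means of the profiles -/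

section OscMean

open Complex in
/-- **The oscillatory mean** `c_S(a) = ∫₀¹ exp(-2πi a S(t)) dt` of a real profile `S` — the mean
of the phase function of the shear with displacement `a S` read by a unit mode
(`Torus.fourierCoeff_twist_scale_zero`). [folklore] -/
def oscMean (S : ℝ → ℝ) (a : ℝ) : ℂ := ∫ t in (0 : ℝ)..1, Complex.exp (-(2 * Real.pi * Complex.I * a * S t))

/-- Pointwise bound `|exp(-2πi a S t)| = 1`. [folklore] -/
theorem norm_exp_phase (a s : ℝ) : ‖Complex.exp (-(2 * Real.pi * Complex.I * a * s))‖ = 1 := by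
  rw [show (-(2 * Real.pi * Complex.I * a * s) : ℂ) = ((-(2 * Real.pi * a * s) : ℝ) : ℂ) * Complex.I by
    push_cast; ring]
  exact Complex.norm_exp_ofReal_mul_I _

end OscMean

section OscMeanEstimates

variable {w : ℝ}

/-- The phase integrand is continuous for a continuous profile. [folklore] -/
theorem continuous_exp_phase {S : ℝ → ℝ} (hS : Continuous S) (a : ℝ) :
    Continuous fun t => Complex.exp (-(2 * Real.pi * Complex.I * a * S t)) := by
  fun_prop

/-- `∫ᵤᵛ exp(c t + d) dt = exp(d) (exp(cv) - exp(cu)) / c` for `c ≠ 0`. [folklore] -/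
theorem integral_exp_affine {c : ℂ} (hc : c ≠ 0) (d : ℂ) (u v : ℝ) :
    ∫ t in u..v, Complex.exp (c * t + d) = Complex.exp d * ((Complex.exp (c * v) - Complex.exp (c * u)) / c) := by
  simp_rw [Complex.exp_add]
  rw [intervalIntegral.integral_mul_const, integral_exp_mul_complex hc]
  ring

/-- `|exp(i x) (…)| `: the norm of `exp(d)` for purely imaginary `d = i y`. [folklore] -/
theorem norm_exp_I_mul_real (y : ℝ) : ‖Complex.exp (Complex.I * y)‖ = 1 := by
  rw [mul_comm]; exact Complex.norm_exp_ofReal_mul_I y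

/-- `|exp(i y) - 1| = 2|sin(y/2)|`, absolute-value form. [folklore] -/
theorem norm_exp_I_mul_sub_one_eq (y : ℝ) : ‖Complex.exp (Complex.I * y) - 1‖ = 2 * |Real.sin (y / 2)| := by
  rw [Complex.norm_exp_I_mul_ofReal_sub_one, Real.norm_eq_abs, abs_mul, abs_two]

/-- **Half-period bound for the triangle wave**: on a half period where `tri` is affine with
slope `4σ`, `σ = ±1`, `|∫ exp(-2πi a tri)| ≤ |sin 2πa| / (4π|a|)`. [folklore] -/
theorem norm_integral_exp_affine_half {a : ℝ} (ha : a ≠ 0) {u : ℝ} {σ k : ℝ} (hσ : σ = 1 ∨ σ = -1)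
    (htri : ∀ t ∈ uIcc u (u + 2⁻¹), tri t = 4 * σ * t + k) :
    ‖∫ t in u..u + 2⁻¹, Complex.exp (-(2 * Real.pi * Complex.I * a * tri t))‖ ≤
      |Real.sin (2 * Real.pi * a)| / (4 * Real.pi * |a|) := by
  have hπ := Real.pi_pos
  set c : ℂ := -(8 * Real.pi * Complex.I * a * σ) with hc_def
  set d : ℂ := -(2 * Real.pi * Complex.I * a * k) with hd_def
  have hσ1 : |σ| = 1 := by rcases hσ with rfl | rfl <;> simp
  have hσne : (σ : ℂ) ≠ 0 := by
    rcases hσ with rfl | rfl <;> simp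
  have hc : c ≠ 0 := by
    rw [hc_def]; simp [Real.pi_ne_zero, Complex.I_ne_zero, ha, hσne]
  have hnc : ‖c‖ = 8 * Real.pi * |a| := by
    rw [hc_def, norm_neg]
    simp [abs_of_pos hπ, hσ1]
  have hint : ∫ t in u..u + 2⁻¹, Complex.exp (-(2 * Real.pi * Complex.I * a * tri t)) =
      ∫ t in u..u + 2⁻¹, Complex.exp (c * t + d) := by
    refine intervalIntegral.integral_congr fun t ht => ?_
    simp only [htri t ht, hc_def, hd_def]
    push_cast
    ring_nf
  rw [hint, integral_exp_affine hc d, norm_mul, hd_def]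
  have hd1 : ‖Complex.exp (-(2 * Real.pi * Complex.I * a * k))‖ = 1 := by
    rw [show (-(2 * Real.pi * Complex.I * a * k) : ℂ) = Complex.I * ((-(2 * Real.pi * a * k) : ℝ) : ℂ) by
      push_cast; ring]
    exact norm_exp_I_mul_real _
  rw [hd1, one_mul, norm_div, hnc]
  -- the numerator: `exp(c(u+1/2)) - exp(cu) = exp(cu) (exp(c/2) - 1)`, `|exp(c/2) - 1| = 2|sin 2πa|`
  have hnum : ‖Complex.exp (c * ((u + 2⁻¹ : ℝ) : ℂ)) - Complex.exp (c * (u : ℂ))‖ = 2 * |Real.sin (2 * Real.pi * a)| := by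
    have e1 : Complex.exp (c * ((u + 2⁻¹ : ℝ) : ℂ)) - Complex.exp (c * (u : ℂ)) =
        Complex.exp (c * (u : ℂ)) * (Complex.exp (c * 2⁻¹) - 1) := by
      rw [mul_sub, mul_one, ← Complex.exp_add]
      push_cast
      ring_nf
    rw [e1, norm_mul]
    have e2 : ‖Complex.exp (c * (u : ℂ))‖ = 1 := by
      rw [show c * (u : ℂ) = Complex.I * ((-(8 * Real.pi * a * σ * u) : ℝ) : ℂ) by rw [hc_def]; push_cast; ring]
      exact norm_exp_I_mul_real _
    have e3 : c * 2⁻¹ = Complex.I * ((-(4 * Real.pi * a * σ) : ℝ) : ℂ) := by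
      rw [hc_def]; push_cast; ring
    rw [e2, one_mul, e3, norm_exp_I_mul_sub_one_eq]
    congr 1
    rcases hσ with rfl | rfl
    · rw [show -(4 * Real.pi * a * 1) / 2 = -(2 * Real.pi * a) by ring, Real.sin_neg, abs_neg]
    · rw [show -(4 * Real.pi * a * -1) / 2 = 2 * Real.pi * a by ring]
  rw [hnum]
  have hpos : 0 < 8 * Real.pi * |a| := by positivity
  rw [div_le_div_iff₀ hpos (by positivity)]
  nlinarith [abs_nonneg (Real.sin (2 * Real.pi * a)), abs_pos.2 ha, hπ]

/-- **The oscillatory mean of the triangle wave**: for `a ≠ 0`,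
`|∫₀¹ exp(-2πi a tri)| ≤ |sin(2πa)| / (2π|a|)` (the exact value is `sin(2πa)/(2πa)`; only the
bound is needed). [folklore] -/
theorem norm_oscMean_tri_le {a : ℝ} (ha : a ≠ 0) :
    ‖oscMean tri a‖ ≤ |Real.sin (2 * Real.pi * a)| / (2 * Real.pi * |a|) := by
  have hc := continuous_exp_phase continuous_tri a
  rw [oscMean, ← intervalIntegral.integral_add_adjacent_intervals (hc.intervalIntegrable (μ := volume) 0 2⁻¹)
    (hc.intervalIntegrable (μ := volume) 2⁻¹ 1)]
  have h1 := norm_integral_exp_affine_half ha (u := 0) (σ := 1) (k := -1) (Or.inl rfl) fun t ht => by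
    rw [zero_add, uIcc_of_le (by norm_num)] at ht
    rw [tri_of_mem_Icc_left ht]; ring
  have h2 := norm_integral_exp_affine_half ha (u := 2⁻¹) (σ := -1) (k := 3) (Or.inr rfl) fun t ht => by
    rw [uIcc_of_le (by norm_num), show (2⁻¹ : ℝ) + 2⁻¹ = 1 by norm_num] at ht
    rw [tri_of_mem_Icc_right ht]; ring
  rw [zero_add] at h1
  rw [show (2⁻¹ : ℝ) + 2⁻¹ = 1 by norm_num] at h2
  refine (norm_add_le _ _).trans ?_
  have : |Real.sin (2 * Real.pi * a)| / (4 * Real.pi * |a|) + |Real.sin (2 * Real.pi * a)| / (4 * Real.pi * |a|) =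
      |Real.sin (2 * Real.pi * a)| / (2 * Real.pi * |a|) := by
    have hne : Real.pi * |a| ≠ 0 := by positivity
    field_simp
    ring
  linarith

/-- A crude bound: the difference of the phase integrands of `S_w` and `tri` has norm `≤ 2`
everywhere and vanishes where `|tri| ≤ 1 - w`. [folklore] -/
theorem norm_exp_phase_sub_le (hw : 0 < w) (a t : ℝ) :
    ‖Complex.exp (-(2 * Real.pi * Complex.I * a * nearTri w t)) - Complex.exp (-(2 * Real.pi * Complex.I * a * tri t))‖ ≤
      if |tri t| ≤ 1 - w then 0 else 2 := by
  split_ifs with h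
  · rw [nearTri_eq_tri hw h, sub_self, norm_zero]
  · exact (norm_sub_le _ _).trans (by rw [norm_exp_phase, norm_exp_phase]; norm_num)

/-- **Flattening the corners costs at most their measure**: `|c_{S_w}(a) - c_{tri}(a)| ≤ 2w`
for every `a` (the integrands agree off the corner windows `[0, w/4] ∪ [1/2 - w/4, 1/2 + w/4] ∪
[1 - w/4, 1]` of the period, and differ by at most `2` on them). [folklore] -/
theorem norm_oscMean_nearTri_sub_le (hw : 0 < w) (hw1 : w ≤ 1) (a : ℝ) :
    ‖oscMean (nearTri w) a - oscMean tri a‖ ≤ 2 * w := by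
  set f : ℝ → ℂ := fun t => Complex.exp (-(2 * Real.pi * Complex.I * a * nearTri w t)) -
    Complex.exp (-(2 * Real.pi * Complex.I * a * tri t)) with hf_def
  have hfc : Continuous f := (continuous_exp_phase (continuous_nearTri hw hw1) a).sub (continuous_exp_phase continuous_tri a)
  have hI : ∀ u v : ℝ, IntervalIntegrable f volume u v := fun u v => hfc.intervalIntegrable u v
  have hosc : oscMean (nearTri w) a - oscMean tri a = ∫ t in (0 : ℝ)..1, f t := by
    rw [oscMean, oscMean, ← intervalIntegral.integral_sub
      ((continuous_exp_phase (continuous_nearTri hw hw1) a).intervalIntegrable _ _)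
      ((continuous_exp_phase continuous_tri a).intervalIntegrable _ _)]
  rw [hosc]
  -- the five pieces of the period
  have hsplit : ∫ t in (0 : ℝ)..1, f t = (∫ t in (0 : ℝ)..w / 4, f t) + (∫ t in (w / 4 : ℝ)..2⁻¹ - w / 4, f t) +
      (∫ t in (2⁻¹ - w / 4 : ℝ)..2⁻¹ + w / 4, f t) + (∫ t in (2⁻¹ + w / 4 : ℝ)..1 - w / 4, f t) +
      ∫ t in (1 - w / 4 : ℝ)..1, f t := by
    rw [intervalIntegral.integral_add_adjacent_intervals (hI _ _) (hI _ _),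
      intervalIntegral.integral_add_adjacent_intervals (hI _ _) (hI _ _),
      intervalIntegral.integral_add_adjacent_intervals (hI _ _) (hI _ _),
      intervalIntegral.integral_add_adjacent_intervals (hI _ _) (hI _ _)]
  -- bounds on each piece
  have hb : ∀ {u v : ℝ} (C : ℝ), u ≤ v → (∀ t ∈ Icc u v, ‖f t‖ ≤ C) → ‖∫ t in u..v, f t‖ ≤ C * (v - u) := by
    intro u v C huv hC
    have h := intervalIntegral.norm_integral_le_of_norm_le_const (a := u) (b := v) (C := C) (f := f) fun t ht => by
      rw [uIoc_of_le huv] at ht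
      exact hC t ⟨ht.1.le, ht.2⟩
    rwa [abs_of_nonneg (by linarith)] at h
  have hf2 : ∀ t, ‖f t‖ ≤ 2 := fun t => by
    refine (norm_exp_phase_sub_le hw a t).trans ?_
    split_ifs <;> norm_num
  have hf0 : ∀ t, |tri t| ≤ 1 - w → ‖f t‖ ≤ 0 := fun t ht => by
    have := norm_exp_phase_sub_le hw a t
    rwa [if_pos ht] at this
  have h1 : ‖∫ t in (0 : ℝ)..w / 4, f t‖ ≤ 2 * (w / 4 - 0) := hb 2 (by linarith) fun t _ => hf2 t
  have h2 : ‖∫ t in (w / 4 : ℝ)..2⁻¹ - w / 4, f t‖ ≤ 0 * (2⁻¹ - w / 4 - w / 4) := by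
    refine hb 0 (by linarith) fun t ht => hf0 t ?_
    rw [tri_of_mem_Icc_left ⟨by linarith [ht.1], by linarith [ht.2]⟩]
    exact abs_le.2 ⟨by linarith [ht.1], by linarith [ht.2]⟩
  have h3 : ‖∫ t in (2⁻¹ - w / 4 : ℝ)..2⁻¹ + w / 4, f t‖ ≤ 2 * (2⁻¹ + w / 4 - (2⁻¹ - w / 4)) :=
    hb 2 (by linarith) fun t _ => hf2 t
  have h4 : ‖∫ t in (2⁻¹ + w / 4 : ℝ)..1 - w / 4, f t‖ ≤ 0 * (1 - w / 4 - (2⁻¹ + w / 4)) := by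
    refine hb 0 (by linarith) fun t ht => hf0 t ?_
    rw [tri_of_mem_Icc_right ⟨by linarith [ht.1], by linarith [ht.2]⟩]
    exact abs_le.2 ⟨by linarith [ht.2], by linarith [ht.1]⟩
  have h5 : ‖∫ t in (1 - w / 4 : ℝ)..1, f t‖ ≤ 2 * (1 - (1 - w / 4)) := hb 2 (by linarith) fun t _ => hf2 t
  rw [hsplit]
  refine (norm_add_le _ _).trans ?_
  refine (add_le_add (norm_add_le _ _) le_rfl).trans ?_
  refine (add_le_add (add_le_add (norm_add_le _ _) le_rfl) le_rfl).trans ?_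
  refine (add_le_add (add_le_add (add_le_add (norm_add_le _ _) le_rfl) le_rfl) le_rfl).trans ?_
  linarith

/-- **Residue bound for the cascade profiles.** At phases `a = l/2 + ε` with `l ∈ ℤ ∖ {0}` and
`|ε| ≤ 1/4`, `|c_{S_w}(a)| ≤ 4|ε| + 2w` (the oscillatory mean of the sharp triangle wave is
`sin(2πa)/(2πa)`, which vanishes at the nonzero half-integers). [folklore] -/
theorem norm_oscMean_nearTri_le (hw : 0 < w) (hw1 : w ≤ 1) {l : ℤ} (hl : l ≠ 0) {ε : ℝ}
    (hε : |ε| ≤ 4⁻¹) : ‖oscMean (nearTri w) (l / 2 + ε)‖ ≤ 4 * |ε| + 2 * w := by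
  have hπ := Real.pi_pos
  set a : ℝ := l / 2 + ε with ha_def
  -- `|a| ≥ 1/4`
  have hl1 : (1 : ℝ) ≤ |(l : ℝ)| := by
    have : (1 : ℤ) ≤ |l| := Int.one_le_abs hl
    exact_mod_cast this
  have ha4 : 4⁻¹ ≤ |a| := by
    have h := abs_sub_abs_le_abs_sub ((l : ℝ) / 2) (-ε)
    rw [sub_neg_eq_add, abs_neg, abs_div, abs_two] at h
    have hε' := abs_nonneg ε
    linarith
  have ha0 : a ≠ 0 := fun h => by rw [h, abs_zero] at ha4; norm_num at ha4
  -- `|sin 2πa| = |sin 2πε| ≤ 2π|ε|`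
  have hsin : |Real.sin (2 * Real.pi * a)| ≤ 2 * Real.pi * |ε| := by
    have e : 2 * Real.pi * a = 2 * Real.pi * ε + l * Real.pi := by rw [ha_def]; ring
    rw [e, Real.sin_add_int_mul_pi, abs_mul, abs_zpow, abs_neg, abs_one, one_zpow, one_mul]
    refine Real.abs_sin_le_abs.trans ?_
    rw [abs_mul, abs_of_pos (by positivity)]
  have htri : ‖oscMean tri a‖ ≤ 4 * |ε| := by
    refine (norm_oscMean_tri_le ha0).trans ?_
    rw [div_le_iff₀ (by positivity)]
    have hε0 := abs_nonneg ε
    have hkey : 2 * Real.pi * |ε| ≤ 4 * |ε| * (2 * Real.pi * |a|) := by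
      have h1 : 0 ≤ 2 * Real.pi * |ε| * (4 * |a| - 1) :=
        mul_nonneg (by positivity) (by linarith)
      nlinarith
    linarith
  calc ‖oscMean (nearTri w) a‖ = ‖oscMean tri a + (oscMean (nearTri w) a - oscMean tri a)‖ := by rw [add_sub_cancel]
    _ ≤ ‖oscMean tri a‖ + ‖oscMean (nearTri w) a - oscMean tri a‖ := norm_add_le _ _
    _ ≤ 4 * |ε| + 2 * w := add_le_add htri (norm_oscMean_nearTri_sub_le hw hw1 a)

/-- **Bridge to the shear phase functions**: the mean of the phase function of the shear with
profile `D S_w(F t)` read by the mode `n` is `c_{S_w}(n D)`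
(`Torus.fourierCoeff_twist_scale_zero`). [folklore] -/
theorem fourierCoeff_twist_profile_scale_zero (hw : 0 < w) (hw1 : w ≤ 1) (D : ℝ) {F : ℕ} (hF : 0 < F)
    (n : ℤ) :
    fourierCoeff (FunctionSpaces.Torus.twist ((profile w hw hw1).scale D F) n) 0 = oscMean (nearTri w) (n * D) := by
  rw [FunctionSpaces.Torus.fourierCoeff_twist_scale_zero _ _ hF, oscMean]
  refine intervalIntegral.integral_congr fun t _ => ?_
  simp only [profile_apply]
  push_cast
  ring_nf

end OscMeanEstimates

end ShearCascade

end Literature.Analysis.FluidPDE
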